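import Mathlib
import Literature.Topology.FourManifolds.TwoHandleTubeDeformationFour
import Literature.Topology.FourManifolds.HandleAttachingMaps
import Literature.AlgebraicTopology.SingularHomology.MayerVietorisExactness
import Literature.AlgebraicTopology.SingularHomology.TripleSequence
import Literature.AlgebraicTopology.Homotopy.StrongDeformationRetractSqueeze
import Literature.AlgebraicTopology.Homotopy.StrongDeformationRetractTransport
import Summits.SmoothPoincare4.SmoothPoincare4.Theorems.ConvexBisectionAcyclicBisectionExistsMultiAttachmentHomologyMV
import HarnessLib

/-!
# Removing the attaching circles of disjoint 4-dimensional 2-handle tubes does not change the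
# homology of the manifold: `Hₙ₊₁(V ∖ ⋃ h̄ᵢ(S)) ≅ Hₙ₊₁(V)`
(helper for stub `stub_isLefschetzHandlebody_homology` = NF5
`Literature.Topology.FourManifolds.LefschetzBase.isLefschetzHandlebody_homology`, line
`modp-braid-orbits` r9, crux `ConvexBisection.AcyclicBisectionExists`, item stmt-SmoothPoincare4-10508;
wave 3 / W3-2: homological version of §2 of `TwoHandleAttachmentPi1.lean` for Kosinski
multi-attachments of `HandleAttachingMap 3 2`, the base piece `V ∖ ⋃ h̄ᵢ(S)` of the
Mayer–Vietoris computation `H₁(V ∪ 2-handles) = H₁(V)/⟨attaching circles⟩`, Gompf–Stipsicz §4.4)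

* §1 **Mayer–Vietoris with one homology-equivalent edge**: for an open-interior cover `Y = A ∪ B`,
  if `Hₖ(A ∩ B) → Hₖ(B)` is an isomorphism for `k = n, n + 1` then so is `Hₙ₊₁(A) → Hₙ₊₁(Y)`
  (diagram chase in Hatcher's exact sequence, §2.2 p. 149, over `…MultiAttachmentHomologyMV.lean`),
  and its transport to two open subsets;
* §2 the tube edge `Hₖ(h̄(T ∖ S)) ≅ Hₖ(h̄(T))` (both retract onto the parallel circle
  `h̄(K_{1/2})`, `TwoHandleTubeDeformationFour.lean`); §3 the trace of a tube on the complement of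
  the attaching circles; §4 **`isIso_map_coresComplement_succ`** by induction over the handles,
  and the registered sub-goal stub `stub_multiAttachment_coresComplement`.

Everything is proved; no named facts, no `sorry`, no definitions.  References: A. Hatcher,
*Algebraic Topology* (2002), §2.2 pp. 149–150 [HatcherAT2002]; A. A. Kosinski, *Differential
Manifolds* (1993), VI §6, X §2 [Kosinski1993]; R. E. Gompf, A. I. Stipsicz, *4-Manifolds and
Kirby Calculus* (1999), §4.4 [GompfStipsicz1999].
-/

noncomputable section

-- the prescribed namespace `Summit.<P>.<Sub>.…` duplicates `SmoothPoincare4` (P = Sub)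
set_option linter.dupNamespace false

open Set Function Metric CategoryTheory CategoryTheory.Limits
open Literature.AlgebraicTopology.SingularHomology Literature.AlgebraicTopology.Homotopy
open Literature.Topology.FourManifolds

namespace Summit.SmoothPoincare4.SmoothPoincare4.Theorems.AcyclicBisectionExists.ModpBraidOrbits

universe u v
variable (R : Type v) [CommRing R] (M : Type v) [AddCommGroup M] [Module R M]

/-! ## §1 Mayer–Vietoris with one homology-equivalent edge -/

section Cover

variable {Y : Type u} [TopologicalSpace Y] (A B : Set Y)

/-- **`Hₙ₊₁(A) → Hₙ₊₁(Y)` is injective** when `Hₙ₊₁(A ∩ B) → Hₙ₊₁(B)` is: if `i_A a = 0` then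
`(a, 0) = φ c = (i c, -i_B c)`, so `c = 0` and `a = 0`. [cite: HatcherAT2002, §2.2 p. 149] -/
theorem injective_map_left_of_mono (hAB : interior A ∪ interior B = univ) (n : ℕ)
    [Mono (singularHomology.map R M (subsetInclusion (inter_subset_right : A ∩ B ⊆ B)) (n + 1))] :
    Function.Injective (singularHomology.map R M (subsetIncl A) (n + 1)) := by
  set iB := singularHomology.map R M (subsetInclusion (inter_subset_right : A ∩ B ⊆ B)) (n + 1)
  have hinjB : Function.Injective iB := (ModuleCat.mono_iff_injective iB).1 inferInstance
  rw [injective_iff_map_eq_zero]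
  intro a ha
  have hψ : mayerVietoris.ψ R M A B (n + 1)
      ((biprod.inl : singularHomology R M A (n + 1) ⟶ _ ⊞ singularHomology R M B (n + 1)) a)
        = 0 := by
    rw [mayerVietoris.ψ, biprod_desc_inl_apply]; exact ha
  obtain ⟨c, hc⟩ := (ShortComplex.moduleCat_exact_iff _).1
    (mayerVietoris.exact₁_holds R M A B hAB (n + 1)) _ hψ
  change mayerVietoris.φ R M A B (n + 1) c = _ at hc
  have h2 := congrArg (biprod.snd : singularHomology R M A (n + 1) ⊞
    singularHomology R M B (n + 1) ⟶ _) hc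
  rw [mayerVietoris.φ, biprod_snd_lift_apply, ← ModuleCat.comp_apply, biprod.inl_snd] at h2
  have hc0 : (-iB) c = 0 := h2
  rw [show (-iB) c = (-iB).hom c from rfl, ModuleCat.hom_neg, LinearMap.neg_apply,
    neg_eq_zero] at hc0
  have hc' : c = 0 := (injective_iff_map_eq_zero _).1 hinjB c hc0
  have h1 := congrArg (biprod.fst : singularHomology R M A (n + 1) ⊞
    singularHomology R M B (n + 1) ⟶ _) hc
  rw [mayerVietoris.φ, biprod_fst_lift_apply, ← ModuleCat.comp_apply, biprod.inl_fst,
    ModuleCat.id_apply, hc', map_zero] at h1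
  exact h1.symm

/-- **`Hₙ₊₁(A) → Hₙ₊₁(Y)` is onto** when `φₙ` is injective and `Hₙ₊₁(A ∩ B) → Hₙ₊₁(B)` is onto:
`z = i_A x + i'_B (i_B y) = i_A (x + i y)`. [cite: HatcherAT2002, §2.2 p. 149] -/
theorem surjective_map_left_of_surjective (hAB : interior A ∪ interior B = univ) (n : ℕ)
    [Mono (mayerVietoris.φ R M A B n)]
    (hs : Function.Surjective
      (singularHomology.map R M (subsetInclusion (inter_subset_right : A ∩ B ⊆ B)) (n + 1))) :
    Function.Surjective (singularHomology.map R M (subsetIncl A) (n + 1)) := by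
  haveI := epi_ψ_of_mono_φ R M A B hAB n
  intro z
  obtain ⟨w, rfl⟩ := (ModuleCat.epi_iff_surjective (mayerVietoris.ψ R M A B (n + 1))).1
    inferInstance z
  obtain ⟨y, hy⟩ := hs ((biprod.snd : singularHomology R M A (n + 1) ⊞
    singularHomology R M B (n + 1) ⟶ _) w)
  refine ⟨(biprod.fst : singularHomology R M A (n + 1) ⊞ singularHomology R M B (n + 1) ⟶ _) w +
    singularHomology.map R M (subsetInclusion (inter_subset_left : A ∩ B ⊆ A)) (n + 1) y, ?_⟩
  conv_rhs => rw [← biprod_apply_decomp w]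
  rw [map_add, map_add, mayerVietoris.ψ, biprod_desc_inl_apply, biprod_desc_inr_apply, ← hy]
  congr 1
  rw [← ModuleCat.comp_apply, ← ModuleCat.comp_apply, ← singularHomology.map_comp,
    ← singularHomology.map_comp, subsetIncl_comp_inter_left_eq]

/-- **Mayer–Vietoris with one homology-equivalent edge**: if `Hₖ(A ∩ B) → Hₖ(B)` is an
isomorphism for `k = n, n + 1` then so is `Hₙ₊₁(A) → Hₙ₊₁(Y)`. [cite: HatcherAT2002, §2.2 p. 149] -/
theorem isIso_map_left_of_isIso_inter_right (hAB : interior A ∪ interior B = univ) (n : ℕ)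
    [IsIso (singularHomology.map R M (subsetInclusion (inter_subset_right : A ∩ B ⊆ B)) n)]
    [IsIso (singularHomology.map R M (subsetInclusion (inter_subset_right : A ∩ B ⊆ B)) (n + 1))] :
    IsIso (singularHomology.map R M (subsetIncl A) (n + 1)) := by
  haveI := mono_φ_of_mono_right R M A B n
  exact (ConcreteCategory.isIso_iff_bijective _).2 ⟨injective_map_left_of_mono R M A B hAB n,
    surjective_map_left_of_surjective R M A B hAB n
      ((ConcreteCategory.isIso_iff_bijective _).1 inferInstance).2⟩

end Cover

section Subsets

variable {X : Type u} [TopologicalSpace X] {U W : Set X}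

/-- On homology, the trace of `U ∩ W ⊆ W` on `U ∪ W` is conjugate to `(U ∩ W ⊆ W)_*`. [folklore] -/
theorem map_trace_right_eq (n : ℕ) :
    singularHomology.map R M (subsetInclusion (inter_subset_right :
        (Subtype.val ⁻¹' U : Set ↥(U ∪ W)) ∩ Subtype.val ⁻¹' W ⊆ Subtype.val ⁻¹' W)) n =
      (singularHomology.mapIso R M (preimageValHomeomorphOfSubset (A := U ∪ W) (B := U ∩ W)
          (inter_subset_left.trans subset_union_left)) n).hom ≫
        singularHomology.map R M (subsetInclusion (inter_subset_right : U ∩ W ⊆ W)) n ≫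
        (singularHomology.mapIso R M (preimageValHomeomorphOfSubset
          (subset_union_right : W ⊆ U ∪ W)) n).inv := by
  rw [singularHomology.mapIso_inv, singularHomology.mapIso_hom, ← singularHomology.map_comp,
    ← singularHomology.map_comp]
  rfl

/-- **`Hₙ₊₁(U) ≅ Hₙ₊₁(U ∪ W)`** for open `U`, `W` when `Hₖ(U ∩ W) → Hₖ(W)` is an isomorphism for
`k = n, n + 1`. [cite: HatcherAT2002, §2.2 p. 149] -/
theorem isIso_map_union_of_isIso_inter (hU : IsOpen U) (hW : IsOpen W) (n : ℕ)
    (hn : IsIso (singularHomology.map R M (subsetInclusion (inter_subset_right : U ∩ W ⊆ W)) n))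
    (hn1 : IsIso (singularHomology.map R M
      (subsetInclusion (inter_subset_right : U ∩ W ⊆ W)) (n + 1))) :
    IsIso (singularHomology.map R M (subsetInclusion (subset_union_left : U ⊆ U ∪ W)) (n + 1)) := by
  haveI : IsIso (singularHomology.map R M (subsetInclusion (inter_subset_right :
      (Subtype.val ⁻¹' U : Set ↥(U ∪ W)) ∩ Subtype.val ⁻¹' W ⊆ Subtype.val ⁻¹' W)) n) := by
    rw [map_trace_right_eq]
    exact @IsIso.comp_isIso _ _ _ _ _ _ _ inferInstance (@IsIso.comp_isIso _ _ _ _ _ _ _ hn inferInstance)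
  haveI : IsIso (singularHomology.map R M (subsetInclusion (inter_subset_right :
      (Subtype.val ⁻¹' U : Set ↥(U ∪ W)) ∩ Subtype.val ⁻¹' W ⊆ Subtype.val ⁻¹' W)) (n + 1)) := by
    rw [map_trace_right_eq]
    exact @IsIso.comp_isIso _ _ _ _ _ _ _ inferInstance (@IsIso.comp_isIso _ _ _ _ _ _ _ hn1 inferInstance)
  haveI := isIso_map_left_of_isIso_inter_right R M (Subtype.val ⁻¹' U : Set ↥(U ∪ W))
    (Subtype.val ⁻¹' W) (interior_union_interior_eq_univ hU hW) n
  rw [map_union_left_eq]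
  infer_instance

/-- Mutually inclusive subsets have isomorphic homology by the inclusion. [folklore] -/
theorem isIso_map_subsetInclusion_of_subset {A B : Set X} (hAB : A ⊆ B) (hBA : B ⊆ A) (n : ℕ) :
    IsIso (singularHomology.map R M (subsetInclusion hAB) n) := by
  refine ⟨⟨singularHomology.map R M (subsetInclusion hBA) n, ?_, ?_⟩⟩ <;>
  · rw [← singularHomology.map_comp]
    exact (congrArg (singularHomology.map R M · n) (by ext x; rfl)).trans
      (singularHomology.map_id R M n)

/-- `Hₙ(univ) ≅ Hₙ(X)` by the inclusion. [folklore] -/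
theorem isIso_map_subsetIncl_univ (n : ℕ) :
    IsIso (singularHomology.map R M (subsetIncl (univ : Set X)) n) := by
  rw [show subsetIncl (univ : Set X) = (Homeomorph.Set.univ X : C(↥(univ : Set X), X)) by ext x; rfl,
    ← singularHomology.mapIso_hom]
  infer_instance

/-- The inclusion of a strong deformation retract induces isomorphisms on homology.
[cite: HatcherAT2002, Cor. 2.11] -/
theorem isIso_map_subsetInclusion_of_sdr {A S : Set X} (h : IsStrongDeformationRetractOf A S)
    (hAS : A ⊆ S) (k : ℕ) : IsIso (singularHomology.map R M (subsetInclusion hAS) k) := by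
  obtain ⟨e, he⟩ := h.exists_homotopyEquiv_inclusion hAS
  have : singularHomology.map R M (subsetInclusion hAS) k =
      (singularHomology.isoOfHomotopyEquiv R M e k).hom := by
    rw [singularHomology.isoOfHomotopyEquiv_hom, he]
  rw [this]
  infer_instance

end Subsets

/-! ## §2 The tube edge `Hₖ(h̄(T ∖ S)) ≅ Hₖ(h̄(T))` -/

section Tube

variable {V : Type u} [TopologicalSpace V] [ChartedSpace (EuclideanHalfSpace (3 + 1)) V]

/-- **The tube edge**: for an attaching map `h̄ : T → V`, `Hₖ(h̄(T ∖ S)) ≅ Hₖ(h̄(T))` by the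
inclusion (both strongly deformation retract onto `h̄(K_{1/2})`). [cite: Kosinski1993, VI §6] -/
theorem isIso_map_tube_of_eq (g : HandleAttachingMap 3 2 V) {S₁ : Set V}
    (hS : S₁ = g.toFun '' {y : ↥(handleTube 3 2) | lamSq 2 y.1.1 ≠ 1}) (hS₁ : S₁ ⊆ range g.toFun)
    (k : ℕ) : IsIso (singularHomology.map R M (subsetInclusion hS₁) k) := by
  subst hS
  set K : Set ↥(handleTube 3 2) := {y | lamSq 2 y.1.1 = (2⁻¹ : ℝ) ^ 2 ∧ muSq 2 y.1.1 = 0} with hK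
  have he : Topology.IsEmbedding g.toFun := g.isSmoothEmbedding.isEmbedding
  have h₁ : IsStrongDeformationRetractOf (g.toFun '' K)
      (g.toFun '' {y : ↥(handleTube 3 2) | lamSq 2 y.1.1 ≠ 1}) :=
    (isStrongDeformationRetractOf_parallel₄_of_lt (c := 2⁻¹) (by norm_num) (by norm_num)
      ).image_of_isEmbedding he
  have h₂ : IsStrongDeformationRetractOf (g.toFun '' K) (range g.toFun) := by
    have h := (isStrongDeformationRetractOf_parallel₄_univ (c := 2⁻¹) (by norm_num)
      (by norm_num)).image_of_isEmbedding he
    rwa [image_univ] at h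
  have hK₁ : g.toFun '' K ⊆ g.toFun '' {y : ↥(handleTube 3 2) | lamSq 2 y.1.1 ≠ 1} := by
    refine image_mono fun y hy => ?_
    rw [mem_setOf_eq, hy.1]; norm_num
  have hK₂ : g.toFun '' K ⊆ range g.toFun := image_subset_range _ _
  haveI i₁ := isIso_map_subsetInclusion_of_sdr R M h₁ hK₁ k
  haveI i₂ := isIso_map_subsetInclusion_of_sdr R M h₂ hK₂ k
  have hfac : singularHomology.map R M (subsetInclusion hK₂) k =
      singularHomology.map R M (subsetInclusion hK₁) k ≫
        singularHomology.map R M (subsetInclusion hS₁) k := by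
    rw [← singularHomology.map_comp]; rfl
  rw [hfac] at i₂
  exact IsIso.of_isIso_comp_left (singularHomology.map R M (subsetInclusion hK₁) k) _

end Tube

/-! ## §3 Disjoint tubes and the complement of the attaching circles -/

section Cores

variable {V : Type u} [TopologicalSpace V] [ChartedSpace (EuclideanHalfSpace (3 + 1)) V]
  {ι : Type*} {h : ι → HandleAttachingMap 3 2 V}
/-- A point `h̄(y)` of a tube is on its attaching circle iff `|y_λ| = 1`. [folklore] -/
theorem apply_mem_core_iff₄ (g : HandleAttachingMap 3 2 V) (y : ↥(handleTube 3 2)) :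
    g.toFun y ∈ g.core ↔ lamSq 2 y.1.1 = 1 := by
  rw [HandleAttachingMap.mem_core_iff]
  exact ⟨fun ⟨y', hy', he⟩ => g.injective he ▸ hy', fun hy => ⟨y, hy, rfl⟩⟩

/-- With pairwise disjoint tubes: **the trace of the `i`-th tube on the complement of the
attaching circles is the image of the punctured tube `T ∖ S`.** [folklore] -/
theorem compl_iUnion_core_inter_range₄
    (hdisj : Pairwise fun i j => Disjoint (range (h i).toFun) (range (h j).toFun)) (i : ι) :
    (⋃ j, (h j).core)ᶜ ∩ range (h i).toFun =
      (h i).toFun '' {y : ↥(handleTube 3 2) | lamSq 2 y.1.1 ≠ 1} := by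
  ext a
  constructor
  · rintro ⟨ha, y, rfl⟩
    refine ⟨y, fun hy => ?_, rfl⟩
    rw [mem_compl_iff, mem_iUnion, not_exists] at ha
    exact ha i ((apply_mem_core_iff₄ (h i) y).2 hy)
  · rintro ⟨y, hy, rfl⟩
    refine ⟨fun hm => ?_, mem_range_self y⟩
    obtain ⟨j, hj⟩ := mem_iUnion.1 hm
    by_cases hji : j = i
    · subst hji
      exact hy ((apply_mem_core_iff₄ (h j) y).1 hj)
    · have hr : (h i).toFun y ∈ range (h j).toFun := by
        obtain ⟨y', -, hy'⟩ := (HandleAttachingMap.mem_core_iff _).1 hj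
        exact ⟨y', hy'⟩
      exact Set.disjoint_left.1 (hdisj (Ne.symm hji)) (mem_range_self y) hr

end Cores

/-! ## §4 `Hₙ₊₁(V ∖ ⋃ h̄ᵢ(S)) ≅ Hₙ₊₁(V)` -/

section Induction

variable {V : Type u} [TopologicalSpace V] [T2Space V] [ChartedSpace (EuclideanHalfSpace (3 + 1)) V]
  {ι : Type*} {h : ι → HandleAttachingMap 3 2 V}

/-- **Adding the tubes one at a time**: the inclusion of `V ∖ ⋃ h̄ⱼ(S)` into
`(V ∖ ⋃ h̄ⱼ(S)) ∪ ⋃_{i ∈ s} h̄ᵢ(T)` induces isomorphisms on `Hₙ₊₁` (Mayer–Vietoris with the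
homology-equivalent edge `h̄ᵢ(T ∖ S) ⊆ h̄ᵢ(T)` at each step). [cite: HatcherAT2002, §2.2 p. 149] -/
theorem isIso_map_coresCompl_finset [Finite ι]
    (hdisj : Pairwise fun i j => Disjoint (range (h i).toFun) (range (h j).toFun)) (n : ℕ)
    (s : Finset ι) : ∀ (P : Set V) (hP : (⋃ j, (h j).core)ᶜ ⊆ P),
      P = (⋃ j, (h j).core)ᶜ ∪ ⋃ i ∈ s, range (h i).toFun →
      IsIso (singularHomology.map R M (subsetInclusion hP) (n + 1)) := by
  classical
  have hopen : IsOpen (⋃ j, (h j).core)ᶜ :=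
    (isClosed_iUnion_of_finite fun j => (h j).isClosed_core).isOpen_compl
  induction s using Finset.induction_on with
  | empty =>
    intro P hP hPe
    refine isIso_map_subsetInclusion_of_subset R M hP ?_ (n + 1)
    rw [hPe]
    simp
  | @insert i s his ih =>
    intro P hP hPe
    set Q : Set V := (⋃ j, (h j).core)ᶜ ∪ ⋃ i ∈ s, range (h i).toFun with hQ
    have hCQ : (⋃ j, (h j).core)ᶜ ⊆ Q := subset_union_left
    obtain rfl : P = Q ∪ range (h i).toFun := by
      rw [hPe, hQ, Finset.set_biUnion_insert]; ac_rfl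
    haveI := ih Q hCQ rfl
    -- the new edge `Q ∩ h̄ᵢ(T) = h̄ᵢ(T ∖ S)`
    have hQi : Q ∩ range (h i).toFun =
        (h i).toFun '' {y : ↥(handleTube 3 2) | lamSq 2 y.1.1 ≠ 1} := by
      rw [← compl_iUnion_core_inter_range₄ hdisj i, hQ, union_inter_distrib_right]
      refine union_eq_left.2 ?_
      rintro a ⟨ha, hai⟩
      rw [mem_iUnion₂] at ha
      obtain ⟨j, hj, haj⟩ := ha
      have hji : j ≠ i := fun e => his (e ▸ hj)
      exact absurd hai (Set.disjoint_left.1 (hdisj hji) haj)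
    have hQo : IsOpen Q :=
      hopen.union (isOpen_biUnion fun i _ => (h i).isOpen_range)
    haveI := isIso_map_union_of_isIso_inter R M hQo (h i).isOpen_range n
      (isIso_map_tube_of_eq R M (h i) hQi inter_subset_right n)
      (isIso_map_tube_of_eq R M (h i) hQi inter_subset_right (n + 1))
    have hfac : singularHomology.map R M (subsetInclusion hP) (n + 1) =
        singularHomology.map R M (subsetInclusion hCQ) (n + 1) ≫
          singularHomology.map R M (subsetInclusion (subset_union_left :
            Q ⊆ Q ∪ range (h i).toFun)) (n + 1) := by
      rw [← singularHomology.map_comp]; rfl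
    rw [hfac]
    infer_instance

/-- **Removing the attaching circles of finitely many disjoint 2-handle tubes does not change the
homology of a 4-manifold in positive degrees**: `Hₙ₊₁(V ∖ ⋃ h̄ⱼ(S); M) ≅ Hₙ₊₁(V; M)` by the
inclusion (Kosinski X §2 proves the analogue for spheres in the interior by general position).
[cite: Kosinski1993, X §2 (proof of Thm. 2.2)] [cite: HatcherAT2002, §2.2 p. 149] -/
theorem isIso_map_coresComplement_succ [Finite ι]
    (hdisj : Pairwise fun i j => Disjoint (range (h i).toFun) (range (h j).toFun)) (n : ℕ) :
    IsIso (singularHomology.map R M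
      (subsetIncl ((HandleAttachingMap.coresComplement h : TopologicalSpace.Opens V) : Set V))
        (n + 1)) := by
  haveI := Fintype.ofFinite ι
  have hcov : (⋃ j, (h j).core)ᶜ ∪ ⋃ i ∈ (Finset.univ : Finset ι), range (h i).toFun = univ := by
    refine eq_univ_iff_forall.2 fun a => ?_
    by_cases ha : a ∈ ⋃ j, (h j).core
    · obtain ⟨j, hj⟩ := mem_iUnion.1 ha
      obtain ⟨y, -, rfl⟩ := (HandleAttachingMap.mem_core_iff _).1 hj
      exact Or.inr (mem_iUnion₂.2 ⟨j, Finset.mem_univ j, mem_range_self y⟩)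
    · exact Or.inl ha
  haveI := isIso_map_coresCompl_finset R M hdisj n Finset.univ univ (subset_univ _) hcov.symm
  haveI := isIso_map_subsetIncl_univ R M (X := V) (n + 1)
  show IsIso (singularHomology.map R M (subsetIncl (⋃ j, (h j).core)ᶜ) (n + 1))
  have hfac : singularHomology.map R M (subsetIncl (⋃ j, (h j).core)ᶜ) (n + 1) =
      singularHomology.map R M (subsetInclusion (subset_univ (⋃ j, (h j).core)ᶜ)) (n + 1) ≫
        singularHomology.map R M (subsetIncl (univ : Set V)) (n + 1) := by
    rw [← singularHomology.map_comp]; rfl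
  rw [hfac]
  infer_instance

end Induction

/-! ## §5 The registered sub-goal stub -/

/-- **`Hₙ₊₁(V ∖ ⋃ h̄ᵢ(S); R) ≅ Hₙ₊₁(V; R)` for disjoint 4-dimensional 2-handle tubes**
(registered sub-goal stub `stub_multiAttachment_coresComplement` of
`stub_isLefschetzHandlebody_homology`): the base piece of Kosinski's model of a multi-attachment
has the homology of `V` in positive degrees. [cite: Kosinski1993, X §2 (proof of Thm. 2.2)] -/
theorem stub_multiAttachment_coresComplement : ∀ (R : Type) [CommRing R] (V : Type)
    [TopologicalSpace V] [T2Space V] [ChartedSpace (EuclideanHalfSpace (3 + 1)) V] (ι : Type)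
    [Finite ι] (h : ι → Literature.Topology.FourManifolds.HandleAttachingMap 3 2 V),
    Pairwise (fun i j => Disjoint (Set.range (h i).toFun) (Set.range (h j).toFun)) →
    ∀ n : ℕ, CategoryTheory.IsIso
      (Literature.AlgebraicTopology.SingularHomology.singularHomology.map R R
        (Literature.AlgebraicTopology.SingularHomology.subsetIncl
          ((Literature.Topology.FourManifolds.HandleAttachingMap.coresComplement h :
            TopologicalSpace.Opens V) : Set V)) (n + 1)) :=
  fun R _ _ _ _ _ _ _ _ hdisj n => isIso_map_coresComplement_succ R R hdisj n

end Summit.SmoothPoincare4.SmoothPoincare4.Theorems.AcyclicBisectionExists.ModpBraidOrbits
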